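import Summits.AtomisticToContinuum.HydrodynamicLimit.Theorems.EnskogAdjointDualityAdjointEnskogTestFamilyRRefPsiOperator
import Summits.AtomisticToContinuum.HydrodynamicLimit.Theorems.EnskogAdjointDualityAdjointEnskogTestFamilyRSphereCalculus
import Literature.Analysis.FunctionSpaces.PeriodicLogCost
import HarnessLib

/-!
# K2R refutation, identity (0), `ψ`-part — preparation II: the bounded transport and operator pieces

Route `EnskogAdjointDuality` of `AtomisticToContinuum/HydrodynamicLimit`, crux K2R
`AdjointEnskogTestFamilyR` (stmt-AtomisticToContinuum-11592), line `refutation`, registered stub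
`stub_psiZero` (file 2 of 3; keyed sub-goal `stub_psiZero_prep2`).

With `Θ₀^R(v) = (1+|v|²)⁻³e^{-|v|²/R}`, `ψ = α + ⟪β,v⟫ + γ|v|²/2`, `‖(α,β,γ)(x)‖ ≤ C`:

* `k2r_ref_p0_weight_one_add_sq` — `∫(1+|v|²)Θ₀^R ≤ 40` uniformly in `R ≥ 1`;
* `k2r_ref_p0_transport` — the transport integrand minus its odd piece `πz sin(2πx₀)γ · Θ₀v₀|v|²` is
  bounded by `(2C|z'| + 4πC|z|)(1+|v|²)Θ₀^R(v)` and integrable on `𝕋³ × ℝ³`;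
* `k2r_ref_p0_L_split` — at a constant background the direction integral of the `w`-integrated
  hard-sphere bracket of `ψ` (`k2r_ref_psi_bracket_integral`, half-Gaussian marginals as hypotheses)
  splits as `Y₀ρ₀(∫_{S²}G_b dσ + ∫_{S²}(γ(x⁺)−γ(x))/2 (⟪v,ω⟫₊)³dσ)` with the bounded remainder
  `G_b = ⟪β(x⁺)−β(x),ω⟫P₂ + (γ(x⁺)−γ(x))/2 (P₃ − (·)₊³)`, `|G_b| ≤ 7C(1+|v|²)`
  (`k2r_ref_p0_Gb_abs_le`, `0 ≤ P₂(a) ≤ 1+a²`, `|P₃(a) − a₊³| ≤ 3(1+|a|)`);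
* `k2r_ref_p0_Sb_integrable` — integrability of `Θ₀ · c cos(2πx₀) ∫_{S²}G_b dσ` on `𝕋³ × ℝ³`
  (continuity on `(𝕋³ × ℝ³) × S²`, domination, Fubini).

References: C. Cercignani, R. Illner, M. Pulvirenti, *The Mathematical Theory of Dilute Gases* (1994),
§3.1 [CIP1994].
-/

noncomputable section

open MeasureTheory Set Filter Function Metric
open scoped InnerProductSpace Real

namespace Summit.AtomisticToContinuum.HydrodynamicLimit.Theorems.EnskogAdjointDuality

open Literature.MathematicalPhysics.KineticTheory Literature.Analysis.FluidPDE Literature.Analysis.FunctionSpaces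

/-- Two bounded moments of the critical weight: `(1+|v|²)Θ₀^R` is integrable with
`∫ (1+|v|²)Θ₀^R dv ≤ 40` uniformly in `R ≥ 1`. [folklore] -/
theorem k2r_ref_p0_weight_one_add_sq {R : ℝ} (hR : 1 ≤ R) :
    Integrable (fun v : V3 => (1 + ‖v‖ ^ 2) * (((1 + ‖v‖ ^ 2) ^ 3)⁻¹ * Real.exp (-‖v‖ ^ 2 / R))) ∧
    ∫ v : V3, (1 + ‖v‖ ^ 2) * (((1 + ‖v‖ ^ 2) ^ 3)⁻¹ * Real.exp (-‖v‖ ^ 2 / R)) ≤ 40 := by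
  obtain ⟨b1, -⟩ := k2r_ref_R3_facts hR
  obtain ⟨i0, v0⟩ := b1 0 (by norm_num)
  obtain ⟨i2, v2⟩ := b1 2 (by norm_num)
  have he : (fun v : V3 => (1 + ‖v‖ ^ 2) * (((1 + ‖v‖ ^ 2) ^ 3)⁻¹ * Real.exp (-‖v‖ ^ 2 / R))) =
      fun v : V3 => ‖v‖ ^ 0 * (((1 + ‖v‖ ^ 2) ^ 3)⁻¹ * Real.exp (-‖v‖ ^ 2 / R)) +
        ‖v‖ ^ 2 * (((1 + ‖v‖ ^ 2) ^ 3)⁻¹ * Real.exp (-‖v‖ ^ 2 / R)) := by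
    funext v; ring
  rw [he]
  refine ⟨i0.add i2, ?_⟩
  rw [integral_add i0 i2]
  linarith

/-! ## The transport part -/

/-- **Transport part of identity (0), bounded piece.** With `ψ = α + ⟪β,v⟫ + γ|v|²/2`,
`‖(α,β,γ)(x)‖ ≤ C`: the integrand `Θ₀^R(v)(−z' cos(2πx₀) ψ + 2πz sin(2πx₀) v₀ (α + ⟪β,v⟫))` is
integrable on `𝕋³ × ℝ³` and bounded pointwise by `(2C|z'| + 4πC|z|)(1+|v|²)Θ₀^R(v)`.
[cite: CIP1994, §3.1] -/
theorem k2r_ref_p0_transport {R C : ℝ} (hR : 1 ≤ R) {cc : T3 → ℝ × V3 × ℝ} (hcc : Continuous cc)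
    (hC : ∀ x, ‖cc x‖ ≤ C) (z z' : ℝ) :
    Integrable (fun p : T3 × V3 => ((1 + ‖p.2‖ ^ 2) ^ 3)⁻¹ * Real.exp (-‖p.2‖ ^ 2 / R) *
        (-(z' * Torus.cosCoord 0 p.1) *
            ((cc p.1).1 + ⟪(cc p.1).2.1, p.2⟫_ℝ + (cc p.1).2.2 * ‖p.2‖ ^ 2 / 2) +
          2 * π * z * Torus.sinCoord 0 p.1 * p.2 0 * ((cc p.1).1 + ⟪(cc p.1).2.1, p.2⟫_ℝ)))
      (volume.prod volume) ∧
    ∀ p : T3 × V3, |((1 + ‖p.2‖ ^ 2) ^ 3)⁻¹ * Real.exp (-‖p.2‖ ^ 2 / R) *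
        (-(z' * Torus.cosCoord 0 p.1) *
            ((cc p.1).1 + ⟪(cc p.1).2.1, p.2⟫_ℝ + (cc p.1).2.2 * ‖p.2‖ ^ 2 / 2) +
          2 * π * z * Torus.sinCoord 0 p.1 * p.2 0 * ((cc p.1).1 + ⟪(cc p.1).2.1, p.2⟫_ℝ))| ≤
      (|z'| * (2 * C) + |z| * (4 * π * C)) *
        ((1 + ‖p.2‖ ^ 2) * (((1 + ‖p.2‖ ^ 2) ^ 3)⁻¹ * Real.exp (-‖p.2‖ ^ 2 / R))) := by
  have hC0 : 0 ≤ C := (norm_nonneg _).trans (hC 0)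
  have hα : ∀ y, |(cc y).1| ≤ C := fun y => by
    have h := norm_fst_le (cc y)
    rw [Real.norm_eq_abs] at h
    exact h.trans (hC y)
  have hβ : ∀ y, ‖(cc y).2.1‖ ≤ C := fun y => (norm_fst_le _).trans ((norm_snd_le _).trans (hC y))
  have hγ : ∀ y, |(cc y).2.2| ≤ C := fun y => by
    have h := (norm_snd_le (cc y).2).trans ((norm_snd_le _).trans (hC y))
    rwa [Real.norm_eq_abs] at h
  have hcosc : Continuous (Torus.cosCoord (0 : Fin 3) : T3 → ℝ) :=
    (Torus.isSmooth_cosCoord 0).continuous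
  have hsinc : Continuous (Torus.sinCoord (0 : Fin 3) : T3 → ℝ) :=
    (Torus.isSmooth_sinCoord 0).continuous
  have hcos : ∀ x : T3, |Torus.cosCoord 0 x| ≤ 1 := Torus.abs_cosCoord_le 0
  have hsin : ∀ x : T3, |Torus.sinCoord 0 x| ≤ 1 := fun x => by
    obtain ⟨x₀, hx⟩ := Torus.exists_coe_eq (x 0)
    rw [Torus.sinCoord_of_eq hx.symm]
    exact Real.abs_sin_le_one _
  have hptw : ∀ p : T3 × V3, |((1 + ‖p.2‖ ^ 2) ^ 3)⁻¹ * Real.exp (-‖p.2‖ ^ 2 / R) *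
        (-(z' * Torus.cosCoord 0 p.1) *
            ((cc p.1).1 + ⟪(cc p.1).2.1, p.2⟫_ℝ + (cc p.1).2.2 * ‖p.2‖ ^ 2 / 2) +
          2 * π * z * Torus.sinCoord 0 p.1 * p.2 0 * ((cc p.1).1 + ⟪(cc p.1).2.1, p.2⟫_ℝ))| ≤
      (|z'| * (2 * C) + |z| * (4 * π * C)) *
        ((1 + ‖p.2‖ ^ 2) * (((1 + ‖p.2‖ ^ 2) ^ 3)⁻¹ * Real.exp (-‖p.2‖ ^ 2 / R))) := by
    intro p
    have ht : 0 ≤ ‖p.2‖ := norm_nonneg _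
    have hv0 : |p.2 0| ≤ ‖p.2‖ := by simpa using PiLp.norm_apply_le p.2 0
    have hin : |⟪(cc p.1).2.1, p.2⟫_ℝ| ≤ C * ‖p.2‖ :=
      (abs_real_inner_le_norm _ _).trans (mul_le_mul_of_nonneg_right (hβ _) ht)
    have hαβ : |(cc p.1).1 + ⟪(cc p.1).2.1, p.2⟫_ℝ| ≤ C * (1 + ‖p.2‖) := by
      refine (abs_add_le _ _).trans ?_
      have := hα p.1
      nlinarith
    have hψ : |(cc p.1).1 + ⟪(cc p.1).2.1, p.2⟫_ℝ + (cc p.1).2.2 * ‖p.2‖ ^ 2 / 2| ≤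
        C * (1 + ‖p.2‖ + ‖p.2‖ ^ 2 / 2) := by
      refine (abs_add_le _ _).trans ?_
      have h2 : |(cc p.1).2.2 * ‖p.2‖ ^ 2 / 2| ≤ C * ‖p.2‖ ^ 2 / 2 := by
        rw [abs_div, abs_mul, abs_two, abs_pow, abs_norm]
        gcongr
        exact hγ p.1
      nlinarith
    have q1 : 1 + ‖p.2‖ + ‖p.2‖ ^ 2 / 2 ≤ 2 * (1 + ‖p.2‖ ^ 2) := by
      nlinarith [sq_nonneg (3 * ‖p.2‖ - 1)]
    have q2 : ‖p.2‖ * (1 + ‖p.2‖) ≤ 2 * (1 + ‖p.2‖ ^ 2) := by nlinarith [sq_nonneg (‖p.2‖ - 1)]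
    have hth0 : 0 ≤ ((1 + ‖p.2‖ ^ 2) ^ 3)⁻¹ * Real.exp (-‖p.2‖ ^ 2 / R) := by positivity
    rw [abs_mul, abs_of_nonneg hth0]
    have key : |-(z' * Torus.cosCoord 0 p.1) *
            ((cc p.1).1 + ⟪(cc p.1).2.1, p.2⟫_ℝ + (cc p.1).2.2 * ‖p.2‖ ^ 2 / 2) +
          2 * π * z * Torus.sinCoord 0 p.1 * p.2 0 * ((cc p.1).1 + ⟪(cc p.1).2.1, p.2⟫_ℝ)| ≤
        (|z'| * (2 * C) + |z| * (4 * π * C)) * (1 + ‖p.2‖ ^ 2) := by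
      calc |-(z' * Torus.cosCoord 0 p.1) *
              ((cc p.1).1 + ⟪(cc p.1).2.1, p.2⟫_ℝ + (cc p.1).2.2 * ‖p.2‖ ^ 2 / 2) +
            2 * π * z * Torus.sinCoord 0 p.1 * p.2 0 * ((cc p.1).1 + ⟪(cc p.1).2.1, p.2⟫_ℝ)|
          ≤ |-(z' * Torus.cosCoord 0 p.1) *
              ((cc p.1).1 + ⟪(cc p.1).2.1, p.2⟫_ℝ + (cc p.1).2.2 * ‖p.2‖ ^ 2 / 2)| +
            |2 * π * z * Torus.sinCoord 0 p.1 * p.2 0 * ((cc p.1).1 + ⟪(cc p.1).2.1, p.2⟫_ℝ)| :=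
            abs_add_le _ _
        _ = |z'| * |Torus.cosCoord 0 p.1| *
              |(cc p.1).1 + ⟪(cc p.1).2.1, p.2⟫_ℝ + (cc p.1).2.2 * ‖p.2‖ ^ 2 / 2| +
            2 * π * |z| * |Torus.sinCoord 0 p.1| * |p.2 0| *
              |(cc p.1).1 + ⟪(cc p.1).2.1, p.2⟫_ℝ| := by
            simp only [abs_mul, abs_neg, abs_two, abs_of_pos Real.pi_pos]
        _ ≤ |z'| * 1 * (C * (1 + ‖p.2‖ + ‖p.2‖ ^ 2 / 2)) +
            2 * π * |z| * 1 * ‖p.2‖ * (C * (1 + ‖p.2‖)) := by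
            gcongr
            · exact hcos p.1
            · exact hsin p.1
        _ = |z'| * C * (1 + ‖p.2‖ + ‖p.2‖ ^ 2 / 2) + 2 * π * |z| * C * (‖p.2‖ * (1 + ‖p.2‖)) := by
            ring
        _ ≤ |z'| * C * (2 * (1 + ‖p.2‖ ^ 2)) + 2 * π * |z| * C * (2 * (1 + ‖p.2‖ ^ 2)) := by
            gcongr
        _ = (|z'| * (2 * C) + |z| * (4 * π * C)) * (1 + ‖p.2‖ ^ 2) := by ring
    calc ((1 + ‖p.2‖ ^ 2) ^ 3)⁻¹ * Real.exp (-‖p.2‖ ^ 2 / R) *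
          |-(z' * Torus.cosCoord 0 p.1) *
              ((cc p.1).1 + ⟪(cc p.1).2.1, p.2⟫_ℝ + (cc p.1).2.2 * ‖p.2‖ ^ 2 / 2) +
            2 * π * z * Torus.sinCoord 0 p.1 * p.2 0 * ((cc p.1).1 + ⟪(cc p.1).2.1, p.2⟫_ℝ)|
        ≤ ((1 + ‖p.2‖ ^ 2) ^ 3)⁻¹ * Real.exp (-‖p.2‖ ^ 2 / R) *
            ((|z'| * (2 * C) + |z| * (4 * π * C)) * (1 + ‖p.2‖ ^ 2)) :=
          mul_le_mul_of_nonneg_left key hth0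
      _ = _ := by ring
  refine ⟨?_, hptw⟩
  have hI := (k2r_ref_p0_weight_one_add_sq hR).1
  have hdom : Integrable (fun p : T3 × V3 => (|z'| * (2 * C) + |z| * (4 * π * C)) *
      ((1 + ‖p.2‖ ^ 2) * (((1 + ‖p.2‖ ^ 2) ^ 3)⁻¹ * Real.exp (-‖p.2‖ ^ 2 / R))))
      ((volume : Measure T3).prod (volume : Measure V3)) := (hI.comp_snd _).const_mul _
  refine hdom.mono' ?_ (ae_of_all _ fun p => by rw [Real.norm_eq_abs]; exact hptw p)
  have hc : Continuous fun p : T3 × V3 => ((1 + ‖p.2‖ ^ 2) ^ 3)⁻¹ * Real.exp (-‖p.2‖ ^ 2 / R) *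
        (-(z' * Torus.cosCoord 0 p.1) *
            ((cc p.1).1 + ⟪(cc p.1).2.1, p.2⟫_ℝ + (cc p.1).2.2 * ‖p.2‖ ^ 2 / 2) +
          2 * π * z * Torus.sinCoord 0 p.1 * p.2 0 * ((cc p.1).1 + ⟪(cc p.1).2.1, p.2⟫_ℝ)) := by
    fun_prop (disch := intros; positivity)
  exact hc.aestronglyMeasurable

/-! ## The operator part -/

section Operator

variable {Y₀ ρ₀ ε : ℝ} {P₂ P₃ : ℝ → ℝ} {cc : T3 → ℝ × V3 × ℝ}

/-- **Splitting `L ψ` at a constant background.** Given the half-Gaussian marginal identities (as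
hypotheses, supplied by `stub_halfGaussian`), the direction integral of the `w`-integrated bracket of
`ψ = α + ⟪β,v⟫ + γ|v|²/2` is `Y₀ρ₀ (∫_{S²} G_b dσ + ∫_{S²} (γ(x⁺)−γ(x))/2 (⟪v,ω⟫₊)³ dσ)` with the bounded
remainder `G_b = ⟪β(x⁺)−β(x),ω⟫P₂(⟪v,ω⟫) + (γ(x⁺)−γ(x))/2 (P₃(⟪v,ω⟫) − (⟪v,ω⟫₊)³)`, `x⁺ = x + εω`.
[cite: CIP1994, §3.1] -/
theorem k2r_ref_p0_L_split (hP₂c : Continuous P₂) (hP₃c : Continuous P₃)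
    (hint : ∀ (ω : sphere (0 : V3) 1) (v : V3), Integrable fun w : V3 =>
      max ⟪v - w, (ω : V3)⟫_ℝ 0 * (1 + ‖w‖ ^ 2) * globalMaxwellian w)
    (hP₂ : ∀ (ω : sphere (0 : V3) 1) (v : V3),
      ∫ w : V3, max ⟪v - w, (ω : V3)⟫_ℝ 0 * ⟪v - w, (ω : V3)⟫_ℝ * globalMaxwellian w = P₂ ⟪v, (ω : V3)⟫_ℝ)
    (hP₃ : ∀ (ω : sphere (0 : V3) 1) (v : V3),
      ∫ w : V3, max ⟪v - w, (ω : V3)⟫_ℝ 0 * (⟪v, (ω : V3)⟫_ℝ ^ 2 - ⟪w, (ω : V3)⟫_ℝ ^ 2) *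
        globalMaxwellian w = P₃ ⟪v, (ω : V3)⟫_ℝ)
    (hcc : Continuous cc) (x : T3) (v : V3) :
    ∫ ω : sphere (0 : V3) 1, (∫ w : V3, max ⟪v - w, (ω : V3)⟫_ℝ 0 * Y₀ * (ρ₀ * globalMaxwellian w) *
        (((cc x).1 + ⟪(cc x).2.1, v - ⟪v - w, (ω : V3)⟫_ℝ • (ω : V3)⟫_ℝ +
            (cc x).2.2 * ‖v - ⟪v - w, (ω : V3)⟫_ℝ • (ω : V3)‖ ^ 2 / 2) +
          ((cc (x + Torus.proj (ε • (ω : V3)))).1 +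
            ⟪(cc (x + Torus.proj (ε • (ω : V3)))).2.1, w + ⟪v - w, (ω : V3)⟫_ℝ • (ω : V3)⟫_ℝ +
            (cc (x + Torus.proj (ε • (ω : V3)))).2.2 * ‖w + ⟪v - w, (ω : V3)⟫_ℝ • (ω : V3)‖ ^ 2 / 2) -
          ((cc x).1 + ⟪(cc x).2.1, v⟫_ℝ + (cc x).2.2 * ‖v‖ ^ 2 / 2) -
          ((cc (x + Torus.proj (ε • (ω : V3)))).1 + ⟪(cc (x + Torus.proj (ε • (ω : V3)))).2.1, w⟫_ℝ +
            (cc (x + Torus.proj (ε • (ω : V3)))).2.2 * ‖w‖ ^ 2 / 2))) ∂sphereMeasure =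
      Y₀ * ρ₀ * ((∫ ω : sphere (0 : V3) 1,
          (⟪(cc (x + Torus.proj (ε • (ω : V3)))).2.1 - (cc x).2.1, (ω : V3)⟫_ℝ * P₂ ⟪v, (ω : V3)⟫_ℝ +
            ((cc (x + Torus.proj (ε • (ω : V3)))).2.2 - (cc x).2.2) / 2 *
              (P₃ ⟪v, (ω : V3)⟫_ℝ - max ⟪v, (ω : V3)⟫_ℝ 0 ^ 3)) ∂sphereMeasure) +
        ∫ ω : sphere (0 : V3) 1, ((cc (x + Torus.proj (ε • (ω : V3)))).2.2 - (cc x).2.2) / 2 *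
          max ⟪v, (ω : V3)⟫_ℝ 0 ^ 3 ∂sphereMeasure) := by
  haveI := isFiniteMeasure_sphereMeasure (E := V3)
  have hxω : Continuous fun ω : sphere (0 : V3) 1 => cc (x + Torus.proj (ε • (ω : V3))) :=
    hcc.comp (continuous_const.add (Torus.continuous_proj.comp (continuous_subtype_val.const_smul ε)))
  have hGb : Continuous fun ω : sphere (0 : V3) 1 =>
      ⟪(cc (x + Torus.proj (ε • (ω : V3)))).2.1 - (cc x).2.1, (ω : V3)⟫_ℝ * P₂ ⟪v, (ω : V3)⟫_ℝ +
        ((cc (x + Torus.proj (ε • (ω : V3)))).2.2 - (cc x).2.2) / 2 *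
          (P₃ ⟪v, (ω : V3)⟫_ℝ - max ⟪v, (ω : V3)⟫_ℝ 0 ^ 3) := by
    have h1 : Continuous fun ω : sphere (0 : V3) 1 => (cc (x + Torus.proj (ε • (ω : V3)))).2.1 :=
      continuous_fst.comp (continuous_snd.comp hxω)
    have h2 : Continuous fun ω : sphere (0 : V3) 1 => (cc (x + Torus.proj (ε • (ω : V3)))).2.2 :=
      continuous_snd.comp (continuous_snd.comp hxω)
    fun_prop
  have hGm : Continuous fun ω : sphere (0 : V3) 1 =>
      ((cc (x + Torus.proj (ε • (ω : V3)))).2.2 - (cc x).2.2) / 2 * max ⟪v, (ω : V3)⟫_ℝ 0 ^ 3 := by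
    have h2 : Continuous fun ω : sphere (0 : V3) 1 => (cc (x + Torus.proj (ε • (ω : V3)))).2.2 :=
      continuous_snd.comp (continuous_snd.comp hxω)
    fun_prop
  have hIb := hGb.integrable_of_hasCompactSupport (μ := sphereMeasure)
    (HasCompactSupport.of_compactSpace _)
  have hIm := hGm.integrable_of_hasCompactSupport (μ := sphereMeasure)
    (HasCompactSupport.of_compactSpace _)
  rw [← integral_add hIb hIm, ← integral_const_mul]
  refine integral_congr_ae (ae_of_all _ fun ω => ?_)
  dsimp only
  rw [k2r_ref_psi_bracket_integral hint hP₂ hP₃ (cc x) (cc (x + Torus.proj (ε • (ω : V3)))) v ω]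
  ring

/-- Pointwise bound of the bounded remainder `G_b` of the `ψ`-bracket: with `0 ≤ P₂(a) ≤ 1 + a²`,
`|P₃(a) − a₊³| ≤ 3(1+|a|)` and `‖(α,β,γ)‖ ≤ C`, `|G_b| ≤ 7C(1+|v|²)`. [cite: CIP1994, §3.1] -/
theorem k2r_ref_p0_Gb_abs_le (hP₂b : ∀ a, 0 ≤ P₂ a ∧ P₂ a ≤ 1 + a ^ 2)
    (hP₃b : ∀ a, |P₃ a - max a 0 ^ 3| ≤ 3 * (1 + |a|)) {C : ℝ} (hC : ∀ x, ‖cc x‖ ≤ C)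
    (x : T3) (v : V3) (ω : sphere (0 : V3) 1) :
    |⟪(cc (x + Torus.proj (ε • (ω : V3)))).2.1 - (cc x).2.1, (ω : V3)⟫_ℝ * P₂ ⟪v, (ω : V3)⟫_ℝ +
        ((cc (x + Torus.proj (ε • (ω : V3)))).2.2 - (cc x).2.2) / 2 *
          (P₃ ⟪v, (ω : V3)⟫_ℝ - max ⟪v, (ω : V3)⟫_ℝ 0 ^ 3)| ≤ 7 * C * (1 + ‖v‖ ^ 2) := by
  have hC0 : 0 ≤ C := (norm_nonneg _).trans (hC x)
  have hβ : ∀ y, ‖(cc y).2.1‖ ≤ C := fun y => (norm_fst_le _).trans ((norm_snd_le _).trans (hC y))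
  have hγ : ∀ y, |(cc y).2.2| ≤ C := fun y => by
    have h := (norm_snd_le (cc y).2).trans ((norm_snd_le _).trans (hC y))
    rwa [Real.norm_eq_abs] at h
  have hω : ‖(ω : V3)‖ = 1 := norm_eq_of_mem_sphere ω
  have ha : |⟪v, (ω : V3)⟫_ℝ| ≤ ‖v‖ := by simpa [hω] using abs_real_inner_le_norm v (ω : V3)
  have h1 : |⟪(cc (x + Torus.proj (ε • (ω : V3)))).2.1 - (cc x).2.1, (ω : V3)⟫_ℝ| ≤ 2 * C := by
    refine (abs_real_inner_le_norm _ _).trans ?_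
    rw [hω, mul_one]
    exact (norm_sub_le _ _).trans (by linarith [hβ (x + Torus.proj (ε • (ω : V3))), hβ x])
  have h2 : |P₂ ⟪v, (ω : V3)⟫_ℝ| ≤ 1 + ‖v‖ ^ 2 := by
    rw [abs_of_nonneg (hP₂b _).1]
    refine (hP₂b _).2.trans ?_
    nlinarith [sq_abs ⟪v, (ω : V3)⟫_ℝ, abs_nonneg ⟪v, (ω : V3)⟫_ℝ]
  have h3 : |((cc (x + Torus.proj (ε • (ω : V3)))).2.2 - (cc x).2.2) / 2| ≤ C := by
    rw [abs_div, abs_two]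
    have := (abs_sub _ _).trans (add_le_add (hγ (x + Torus.proj (ε • (ω : V3)))) (hγ x))
    linarith
  have h4 : |P₃ ⟪v, (ω : V3)⟫_ℝ - max ⟪v, (ω : V3)⟫_ℝ 0 ^ 3| ≤ 3 * (1 + ‖v‖) :=
    (hP₃b _).trans (by linarith)
  calc |⟪(cc (x + Torus.proj (ε • (ω : V3)))).2.1 - (cc x).2.1, (ω : V3)⟫_ℝ * P₂ ⟪v, (ω : V3)⟫_ℝ +
        ((cc (x + Torus.proj (ε • (ω : V3)))).2.2 - (cc x).2.2) / 2 *
          (P₃ ⟪v, (ω : V3)⟫_ℝ - max ⟪v, (ω : V3)⟫_ℝ 0 ^ 3)|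
      ≤ |⟪(cc (x + Torus.proj (ε • (ω : V3)))).2.1 - (cc x).2.1, (ω : V3)⟫_ℝ * P₂ ⟪v, (ω : V3)⟫_ℝ| +
        |((cc (x + Torus.proj (ε • (ω : V3)))).2.2 - (cc x).2.2) / 2 *
          (P₃ ⟪v, (ω : V3)⟫_ℝ - max ⟪v, (ω : V3)⟫_ℝ 0 ^ 3)| := abs_add_le _ _
    _ = |⟪(cc (x + Torus.proj (ε • (ω : V3)))).2.1 - (cc x).2.1, (ω : V3)⟫_ℝ| * |P₂ ⟪v, (ω : V3)⟫_ℝ| +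
        |((cc (x + Torus.proj (ε • (ω : V3)))).2.2 - (cc x).2.2) / 2| *
          |P₃ ⟪v, (ω : V3)⟫_ℝ - max ⟪v, (ω : V3)⟫_ℝ 0 ^ 3| := by rw [abs_mul, abs_mul]
    _ ≤ 2 * C * (1 + ‖v‖ ^ 2) + C * (3 * (1 + ‖v‖)) := by gcongr
    _ ≤ 7 * C * (1 + ‖v‖ ^ 2) := by
        have h5 : 3 * (1 + ‖v‖) ≤ 5 * (1 + ‖v‖ ^ 2) := by nlinarith [sq_nonneg (‖v‖ - 1), norm_nonneg v]
        nlinarith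

/-- The direction integral of the bounded remainder: `|∫_{S²} G_b dσ| ≤ 4π · 7C(1+|v|²)`.
[cite: CIP1994, §3.1] -/
theorem k2r_ref_p0_Gb_integral_abs_le (hP₂b : ∀ a, 0 ≤ P₂ a ∧ P₂ a ≤ 1 + a ^ 2)
    (hP₃b : ∀ a, |P₃ a - max a 0 ^ 3| ≤ 3 * (1 + |a|)) {C : ℝ} (hC : ∀ x, ‖cc x‖ ≤ C)
    (x : T3) (v : V3) :
    |∫ ω : sphere (0 : V3) 1,
        (⟪(cc (x + Torus.proj (ε • (ω : V3)))).2.1 - (cc x).2.1, (ω : V3)⟫_ℝ * P₂ ⟪v, (ω : V3)⟫_ℝ +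
          ((cc (x + Torus.proj (ε • (ω : V3)))).2.2 - (cc x).2.2) / 2 *
            (P₃ ⟪v, (ω : V3)⟫_ℝ - max ⟪v, (ω : V3)⟫_ℝ 0 ^ 3)) ∂sphereMeasure| ≤
      4 * π * (7 * C * (1 + ‖v‖ ^ 2)) := by
  haveI := isFiniteMeasure_sphereMeasure (E := V3)
  calc _ ≤ 7 * C * (1 + ‖v‖ ^ 2) * (sphereMeasure : Measure (sphere (0 : V3) 1)).real univ := by
        rw [← Real.norm_eq_abs]
        exact norm_integral_le_of_norm_le_const (ae_of_all _ fun ω => by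
          rw [Real.norm_eq_abs]; exact k2r_ref_p0_Gb_abs_le hP₂b hP₃b hC x v ω)
    _ = _ := by rw [k2r_sphereMeasure_real_univ]; ring

/-- **Integrability of the bounded operator piece** `Θ₀^R(v) · c cos(2πx₀) ∫_{S²} G_b dσ` on
`𝕋³ × ℝ³` (continuity on `(𝕋³ × ℝ³) × S²`, domination by `|c| 7C (1+|v|²) Θ₀^R`, Fubini).
[cite: CIP1994, §3.1] -/
theorem k2r_ref_p0_Sb_integrable {R : ℝ} (hR : 1 ≤ R) (hP₂c : Continuous P₂) (hP₃c : Continuous P₃)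
    (hP₂b : ∀ a, 0 ≤ P₂ a ∧ P₂ a ≤ 1 + a ^ 2) (hP₃b : ∀ a, |P₃ a - max a 0 ^ 3| ≤ 3 * (1 + |a|))
    (hcc : Continuous cc) {C : ℝ} (hC : ∀ x, ‖cc x‖ ≤ C) (c : ℝ) :
    Integrable (fun p : T3 × V3 => ((1 + ‖p.2‖ ^ 2) ^ 3)⁻¹ * Real.exp (-‖p.2‖ ^ 2 / R) *
      (c * Torus.cosCoord 0 p.1 * ∫ ω : sphere (0 : V3) 1,
        (⟪(cc (p.1 + Torus.proj (ε • (ω : V3)))).2.1 - (cc p.1).2.1, (ω : V3)⟫_ℝ * P₂ ⟪p.2, (ω : V3)⟫_ℝ +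
          ((cc (p.1 + Torus.proj (ε • (ω : V3)))).2.2 - (cc p.1).2.2) / 2 *
            (P₃ ⟪p.2, (ω : V3)⟫_ℝ - max ⟪p.2, (ω : V3)⟫_ℝ 0 ^ 3)) ∂sphereMeasure)) (volume.prod volume) := by
  haveI := isFiniteMeasure_sphereMeasure (E := V3)
  have hcosc : Continuous (Torus.cosCoord (0 : Fin 3) : T3 → ℝ) :=
    (Torus.isSmooth_cosCoord 0).continuous
  have hC0 : 0 ≤ C := (norm_nonneg _).trans (hC 0)
  set H : (T3 × V3) × sphere (0 : V3) 1 → ℝ := fun q =>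
    ((1 + ‖q.1.2‖ ^ 2) ^ 3)⁻¹ * Real.exp (-‖q.1.2‖ ^ 2 / R) * (c * Torus.cosCoord 0 q.1.1) *
      (⟪(cc (q.1.1 + Torus.proj (ε • (q.2 : V3)))).2.1 - (cc q.1.1).2.1, (q.2 : V3)⟫_ℝ *
          P₂ ⟪q.1.2, (q.2 : V3)⟫_ℝ +
        ((cc (q.1.1 + Torus.proj (ε • (q.2 : V3)))).2.2 - (cc q.1.1).2.2) / 2 *
          (P₃ ⟪q.1.2, (q.2 : V3)⟫_ℝ - max ⟪q.1.2, (q.2 : V3)⟫_ℝ 0 ^ 3)) with hH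
  have hHc : Continuous H := by
    simp only [hH]
    have hp : Continuous fun q : (T3 × V3) × sphere (0 : V3) 1 =>
        cc (q.1.1 + Torus.proj (ε • (q.2 : V3))) :=
      hcc.comp (continuous_fst.fst.add (Torus.continuous_proj.comp
        ((continuous_subtype_val.comp continuous_snd).const_smul ε)))
    have h1 : Continuous fun q : (T3 × V3) × sphere (0 : V3) 1 =>
        (cc (q.1.1 + Torus.proj (ε • (q.2 : V3)))).2.1 := continuous_fst.comp (continuous_snd.comp hp)
    have h2 : Continuous fun q : (T3 × V3) × sphere (0 : V3) 1 =>
        (cc (q.1.1 + Torus.proj (ε • (q.2 : V3)))).2.2 := continuous_snd.comp (continuous_snd.comp hp)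
    fun_prop (disch := intros; positivity)
  have hI := (k2r_ref_p0_weight_one_add_sq hR).1
  have hdom : Integrable (fun q : (T3 × V3) × sphere (0 : V3) 1 => |c| * (7 * C) *
      ((1 + ‖q.1.2‖ ^ 2) * (((1 + ‖q.1.2‖ ^ 2) ^ 3)⁻¹ * Real.exp (-‖q.1.2‖ ^ 2 / R))))
      (((volume : Measure T3).prod (volume : Measure V3)).prod sphereMeasure) :=
    ((hI.comp_snd (volume : Measure T3)).comp_fst _).const_mul _
  have hHi : Integrable H (((volume : Measure T3).prod (volume : Measure V3)).prod sphereMeasure) := by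
    refine hdom.mono' hHc.aestronglyMeasurable (ae_of_all _ fun q => ?_)
    have hb := k2r_ref_p0_Gb_abs_le (ε := ε) hP₂b hP₃b hC q.1.1 q.1.2 q.2
    have hcs : |Torus.cosCoord 0 q.1.1| ≤ 1 := Torus.abs_cosCoord_le 0 _
    have hth0 : 0 ≤ ((1 + ‖q.1.2‖ ^ 2) ^ 3)⁻¹ * Real.exp (-‖q.1.2‖ ^ 2 / R) := by positivity
    simp only [hH, Real.norm_eq_abs]
    rw [abs_mul, abs_mul, abs_of_nonneg hth0, abs_mul]
    calc ((1 + ‖q.1.2‖ ^ 2) ^ 3)⁻¹ * Real.exp (-‖q.1.2‖ ^ 2 / R) * (|c| * |Torus.cosCoord 0 q.1.1|) *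
          |⟪(cc (q.1.1 + Torus.proj (ε • (q.2 : V3)))).2.1 - (cc q.1.1).2.1, (q.2 : V3)⟫_ℝ *
              P₂ ⟪q.1.2, (q.2 : V3)⟫_ℝ +
            ((cc (q.1.1 + Torus.proj (ε • (q.2 : V3)))).2.2 - (cc q.1.1).2.2) / 2 *
              (P₃ ⟪q.1.2, (q.2 : V3)⟫_ℝ - max ⟪q.1.2, (q.2 : V3)⟫_ℝ 0 ^ 3)|
        ≤ ((1 + ‖q.1.2‖ ^ 2) ^ 3)⁻¹ * Real.exp (-‖q.1.2‖ ^ 2 / R) * (|c| * 1) *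
            (7 * C * (1 + ‖q.1.2‖ ^ 2)) := by gcongr
      _ = _ := by ring
  have h := hHi.integral_prod_left
  have hinner : ∀ p : T3 × V3, ∫ ω, H (p, ω) ∂sphereMeasure =
      ((1 + ‖p.2‖ ^ 2) ^ 3)⁻¹ * Real.exp (-‖p.2‖ ^ 2 / R) *
        (c * Torus.cosCoord 0 p.1 * ∫ ω : sphere (0 : V3) 1,
          (⟪(cc (p.1 + Torus.proj (ε • (ω : V3)))).2.1 - (cc p.1).2.1, (ω : V3)⟫_ℝ * P₂ ⟪p.2, (ω : V3)⟫_ℝ +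
            ((cc (p.1 + Torus.proj (ε • (ω : V3)))).2.2 - (cc p.1).2.2) / 2 *
              (P₃ ⟪p.2, (ω : V3)⟫_ℝ - max ⟪p.2, (ω : V3)⟫_ℝ 0 ^ 3)) ∂sphereMeasure) := fun p => by
    simp only [hH]
    rw [← integral_const_mul, ← integral_const_mul]
    exact integral_congr_ae (ae_of_all _ fun ω => by ring)
  simp only [hinner] at h
  exact h

end Operator

/-- **Registered sub-goal `stub_psiZero_prep2`** (keyed theorem of this preparatory file): the
uniform bound `∫(1+|v|²)Θ₀^R dv ≤ 40`, `k2r_ref_p0_weight_one_add_sq`. [folklore] -/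
theorem stub_psiZero_prep2 : ∀ R : ℝ, 1 ≤ R →
    ∫ v : EuclideanSpace ℝ (Fin 3), (1 + ‖v‖ ^ 2) * (((1 + ‖v‖ ^ 2) ^ 3)⁻¹ * Real.exp (-‖v‖ ^ 2 / R)) ≤ 40 :=
  fun _ hR => (k2r_ref_p0_weight_one_add_sq hR).2

end Summit.AtomisticToContinuum.HydrodynamicLimit.Theorems.EnskogAdjointDuality
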